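import Mathlib
import HarnessLib
import Summits.AtomisticToContinuum.HydrodynamicLimit.Theses.OneFlightGossipEngine
import Summits.AtomisticToContinuum.HydrodynamicLimit.Theorems.OneFlightGossipEngineKineticCurrentsWindowLDUniformOfFamilies

/-!
# Logical frame of the engine-contract glue `GossipConsumptionGlue` (stmt-AtomisticToContinuum-16766)

Route `OneFlightGossipEngine`, sub-problem `HydrodynamicLimit`. The support item
`GossipConsumptionGlue := OneFlightLayeredChaos → KineticCurrentsLDAlongFamilies` (rev 26) says that
the rank-2 mechanism crux B1′ (one-flight angular chaos per collision given the coarse past, typed at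
GLOBAL Gibbs with constant profiles) delivers the rank-3 docking node (the finite-kinetic-window LD
at scale `N` for the restricted class of fast kinetic currents, under LOCAL Gibbs data, thresholds
uniform along jointly continuous families).

This file kernel-checks only the LOGICAL FRAME in which the item sits, for the planner's record
(pure logic, no analysis; it supports the item without closing it):

* the two ways the item can close as typed — from the node itself
  (`gossipConsumptionGlue_of_kineticCurrentsLDAlongFamilies`) or ex falso from a refutation of B1′
  (`gossipConsumptionGlue_of_not_oneFlightLayeredChaos`);
* its intended use, glue + B1′ ⇒ node (`kineticCurrentsLDAlongFamilies_of_glue`), i.e. the sense in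
  which B1′ "sits inside the cone of `closes`";
* that the rev-26 glue subsumes the dropped rev-17 glue `OneFlightLayeredChaos →
  KineticCurrentsWindowLDUniform` (stmt-14945), through the landed constant-family rung
  `kineticCurrentsWindowLDUniform_of_alongFamilies` (`gossipConsumptionGlue_pointwise`).

The mathematical content of the item (why it is crux-sized as typed: global-vs-local Gibbs scope,
the fixed-`σ` defect floor `Cσ^p` against `∀ ε ∃ τ₀`, and the σ-algebra mismatch between B1′'s
two-flight-start coarse past and the kick filtrations of the LD lines) is recorded in the item's
evidence file `GLUE-ANALYSIS.md`, not here.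
-/

namespace Summit.AtomisticToContinuum.HydrodynamicLimit.Theorems

open Summit.AtomisticToContinuum.HydrodynamicLimit.Theses.OneFlightGossipEngine

/-- **Closure route 1.** The glue follows from the docking node `KineticCurrentsLDAlongFamilies`
(stmt-AtomisticToContinuum-16659) alone: as typed, the item is dominated by the rank-3 crux it is
meant to produce. [folklore] -/
theorem gossipConsumptionGlue_of_kineticCurrentsLDAlongFamilies
    (hK : KineticCurrentsLDAlongFamilies) : GossipConsumptionGlue :=
  fun _ => hK

/-- **Closure route 2.** The glue follows ex falso from a refutation of the mechanism crux
`OneFlightLayeredChaos` (stmt-AtomisticToContinuum-14535). [folklore] -/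
theorem gossipConsumptionGlue_of_not_oneFlightLayeredChaos
    (hB : ¬ OneFlightLayeredChaos) : GossipConsumptionGlue :=
  fun h => absurd h hB

/-- **Intended use.** Glue and mechanism crux together give the docking node, the binder `hK` of
the route's deciding theorem `closes` (modus ponens). [folklore] -/
theorem kineticCurrentsLDAlongFamilies_of_glue
    (hG : GossipConsumptionGlue) (hB : OneFlightLayeredChaos) : KineticCurrentsLDAlongFamilies :=
  hG hB

/-- **The rev-26 glue subsumes the rev-17 glue.** From `GossipConsumptionGlue` the dropped
engine contract `OneFlightLayeredChaos → KineticCurrentsWindowLDUniform` (stmt-14945, pointwise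
docking node stmt-14662) follows through the constant-family rung
`kineticCurrentsWindowLDUniform_of_alongFamilies`. [folklore] -/
theorem gossipConsumptionGlue_pointwise (hG : GossipConsumptionGlue) :
    OneFlightLayeredChaos → KineticCurrentsWindowLDUniform :=
  fun hB => kineticCurrentsWindowLDUniform_of_alongFamilies (hG hB)

end Summit.AtomisticToContinuum.HydrodynamicLimit.Theorems
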